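import Literature.NumberTheory.EllipticCurves.CongruenceVisibilityMultiplicativeTwisted
import Literature.NumberTheory.EllipticCurves.LocalFrobeniusGenerationProofs
import Literature.NumberTheory.GaloisRepresentations.GaloisCohomologyKummerProofs
import HarnessLib

/-!
# Preliminaries for "unramified classes at a non-split multiplicative place" (cell `b2b-bsdres`,
# team n1011, row T-NSK = route planner 1's kind (iv′); seat p04 GEN 10; skeleton
# `cells/n1011/skel/T-NSK.md`)

HONEST FRAMING (cell `b2b-bsdres`, run/shared/lean/b2b/bsd-rank1-residual/, verbatim in every
file): the goal of the cell is to DELETE the COMBINATION-SHAPED residual classes of the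
Birch–Swinnerton-Dyer formula for ALL analytic-rank `≤ 1` elliptic curves over `ℚ` — "full BSD
formula for every rank `≤ 1` curve in class `C`" assembled STRICTLY from published theorems — so
that the rank-`≤ 1` remainder becomes exactly the CONSTRUCTION-SHAPED classes, which are TYPED
(missing-input `Prop`s), NOT attempted. This is not "finishing BSD". Team n1011 (N10 / N11, the
additive block X4 ∧ `p = 3`): research route on the CONSTRUCTION-SHAPED class X4; no claim beyond
the stated classes; nothing is booked; no mark / label / count is changed by this file. Theorems
only (no definition, no named fact, no `sorry`); everything here is general and cell-independent.

## What

Small generic tools for the main file `NonsplitMultiplicativeUnramifiedLocal.lean` (the cocycle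
form of Milne, *ADT*, Prop. I.3.8 at a place of NON-SPLIT multiplicative reduction, proved from the
twisted Tate uniformisation):

* `isArithFrobAt_mul_of_mem_inertia` — a Frobenius times an inertia element is a Frobenius;
* `continuous_restrictScalars` — restriction `Gal(L/L₀) → Gal(L/F)` is continuous for the Krull
  topologies (`F ⊆ L₀ ⊆ L`), the transport needed to apply the tree's Hilbert 90
  (`AlgEquiv.exists_smul_div_eq_of_isOpen`) on the subgroup `Gal(K̄_v/K_v(√γ)) ≤ Γ_{K_v}`;
* crossed-homomorphism algebra (`crossedHom_one`, `crossedHom_inv`, `crossedHom_sub_coboundary`,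
  `exists_subgroup_coe_eq_zeroSet`, `smul_eq_of_normal`);
* for a Tate parametrisation `Ψ : K̄_vˣ → E(K̄_v)` with kernel `q^ℤ`, `0 < |q|_v < 1` (the SHAPE
  delivered by `Silverman1994_thmV53_corV54_tateUniformisation`, entering as explicit hypotheses,
  so nothing here is conditional): `eq_of_pow_eq_one_of_map_ofMul_eq` (`Ψ` is injective on
  `μ_p`), `exists_subgroup_coe_eq_setOf_mem_line` (the `σ` at which a crossed homomorphism takes
  values on the line `Ψ(μ_p)` form a subgroup), and `exists_isArithFrobAt_apply_ne` (a local
  arithmetic Frobenius moving `√γ` exists as soon as some element of `Γ_{K_v}` moves it — density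
  of `⟨F, I_𝔐⟩`, `eq_top_of_isOpen_of_frobenius_mem_of_inertia_le`).

References: J. Neukirch, *Algebraic Number Theory*, Ch. I §9, Ch. II §9 [NeukirchANT1999];
J.-P. Serre, *Local Fields*, Ch. X §1 [Serre1979]; J. H. Silverman, *ATAEC*, Ch. V §§3–5
[SilvermanATAEC1994].

## Design

`noncomputable section`; universe `0` for the number field (as in
`CongruenceVisibilityMultiplicative*.lean`); no local notation (the Galois action on `K̄_v` is
written `absoluteGaloisGroup.toAlgEquiv K_v σ`, on `K̄_vˣ` through `Units.map`).
-/

noncomputable section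

open scoped Classical Topology
open Field NumberField IsDedekindDomain WeierstrassCurve
open Literature.NumberTheory.EllipticCurves Literature.NumberTheory.GaloisRepresentations

namespace Summit.BirchSwinnertonDyer.Rank1Residual.GaloisImage

namespace NonsplitKummer

/-! ### §0. Helpers -/

section Frobenius

variable {R S G : Type*} [CommRing R] [CommRing S] [Algebra R S] [Group G]
  [MulSemiringAction G S] [SMulCommClass G R S]

/-- **A Frobenius times an inertia element is a Frobenius.**  If `F` is an arithmetic Frobenius at
the ideal `Q` (`F • x ≡ x ^ q (mod Q)`) and `τ` lies in the inertia group of `Q`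
(`τ • x ≡ x (mod Q)`), then `F * τ` is again an arithmetic Frobenius at `Q`.
Neukirch, *ANT*, Ch. I §9 (9.4). [folklore] -/
theorem isArithFrobAt_mul_of_mem_inertia {Q : Ideal S} {F τ : G}
    (hF : IsArithFrobAt R F Q) (hτ : τ ∈ Q.inertia G) : IsArithFrobAt R (F * τ) Q := by
  intro x
  have h1 : F • (τ • x) - (τ • x) ^ Nat.card (R ⧸ Q.under R) ∈ Q := hF (τ • x)
  have h2 : (τ • x) ^ Nat.card (R ⧸ Q.under R) - x ^ Nat.card (R ⧸ Q.under R) ∈ Q := by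
    rw [← Ideal.Quotient.mk_eq_mk_iff_sub_mem, map_pow, map_pow,
      (Ideal.Quotient.mk_eq_mk_iff_sub_mem _ _).mpr (hτ x)]
  have h := add_mem h1 h2
  rw [sub_add_sub_cancel, ← mul_smul] at h
  exact h

end Frobenius

section Krull

/-- **Restriction of scalars `Gal(L/L₀) → Gal(L/F)` is continuous** for the Krull topologies, for an
intermediate field `F ⊆ L₀ ⊆ L`: the preimage of `Gal(L/E)`, `E/F` finite, contains `Gal(L/L₀(E))`
with `L₀(E)/L₀` finite. [folklore] -/
theorem continuous_restrictScalars (F : Type*) {L : Type*} [Field F] [Field L] [Algebra F L]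
    (L₀ : IntermediateField F L) :
    Continuous fun g : (L ≃ₐ[L₀] L) ↦ g.restrictScalars F := by
  let ψ : (L ≃ₐ[L₀] L) →* (L ≃ₐ[F] L) :=
    { toFun := fun g ↦ g.restrictScalars F
      map_one' := by ext; rfl
      map_mul' := fun _ _ ↦ by ext; rfl }
  change Continuous ψ
  refine continuous_of_continuousAt_one ψ ?_
  rw [ContinuousAt, map_one]
  intro s hs
  obtain ⟨E, hE, hEs⟩ := (krullTopology_mem_nhds_one_iff F L s).mp hs
  rw [Filter.mem_map, krullTopology_mem_nhds_one_iff]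
  let b := Module.finBasis F E
  let T : Set L := Set.range fun i ↦ ((b i : E) : L)
  haveI : Finite T := (Set.finite_range _).to_subtype
  have hTint : ∀ x ∈ T, IsIntegral L₀ x := by
    rintro _ ⟨i, rfl⟩
    exact ((IsIntegral.of_finite F (b i)).map (IntermediateField.val E)).tower_top
  haveI : FiniteDimensional L₀ (IntermediateField.adjoin L₀ T) :=
    IntermediateField.finiteDimensional_adjoin hTint
  refine ⟨IntermediateField.adjoin L₀ T, inferInstance, fun g hg ↦ hEs ?_⟩
  rw [SetLike.mem_coe, IntermediateField.mem_fixingSubgroup_iff] at hg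
  rw [SetLike.mem_coe, IntermediateField.mem_fixingSubgroup_iff]
  intro x hx
  have hx' : (x : L) = ∑ i, (b.repr ⟨x, hx⟩ i) • ((b i : E) : L) := by
    have h := congrArg (fun y : E ↦ (y : L)) (b.sum_repr ⟨x, hx⟩)
    simp only [AddSubmonoidClass.coe_finsetSum, SetLike.val_smul] at h
    exact h.symm
  change g.restrictScalars F x = x
  rw [hx', map_sum]
  refine Finset.sum_congr rfl fun i _ ↦ ?_
  rw [map_smul]
  congr 1
  exact hg _ (IntermediateField.subset_adjoin L₀ T ⟨i, rfl⟩)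

end Krull

section CrossedHom

variable {Γ M : Type*} [Group Γ] [AddCommGroup M] [DistribMulAction Γ M] {g : Γ → M}

/-- A crossed homomorphism vanishes at `1`. [folklore] -/
theorem crossedHom_one (hg : ∀ σ τ, g (σ * τ) = g σ + σ • g τ) : g 1 = 0 := by
  have h := hg 1 1
  rwa [mul_one, one_smul, left_eq_add] at h

/-- A crossed homomorphism at an inverse: `g σ⁻¹ = -(σ⁻¹ • g σ)`. [folklore] -/
theorem crossedHom_inv (hg : ∀ σ τ, g (σ * τ) = g σ + σ • g τ) (σ : Γ) :
    g σ⁻¹ = -(σ⁻¹ • g σ) := by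
  have h := hg σ⁻¹ σ
  rw [inv_mul_cancel, crossedHom_one hg] at h
  exact eq_neg_of_add_eq_zero_left h.symm

/-- Subtracting a coboundary `σ ↦ σ • x - x` from a crossed homomorphism gives a crossed
homomorphism. [folklore] -/
theorem crossedHom_sub_coboundary (hg : ∀ σ τ, g (σ * τ) = g σ + σ • g τ) (x : M) :
    ∀ σ τ, (g (σ * τ) - ((σ * τ) • x - x)) =
      (g σ - (σ • x - x)) + σ • (g τ - (τ • x - x)) := by
  intro σ τ
  rw [hg, mul_smul, smul_sub, smul_sub]
  abel

/-- The zero set of a crossed homomorphism is (the carrier of) a subgroup. [folklore] -/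
theorem exists_subgroup_coe_eq_zeroSet (hg : ∀ σ τ, g (σ * τ) = g σ + σ • g τ) :
    ∃ Z : Subgroup Γ, (Z : Set Γ) = {σ | g σ = 0} :=
  ⟨{ carrier := {σ | g σ = 0}
     one_mem' := crossedHom_one hg
     mul_mem' := fun {σ τ} hσ hτ ↦ by
       simp only [Set.mem_setOf_eq] at hσ hτ ⊢
       rw [hg, hσ, hτ, smul_zero, add_zero]
     inv_mem' := fun {σ} hσ ↦ by
       simp only [Set.mem_setOf_eq] at hσ ⊢
       rw [crossedHom_inv hg, hσ, smul_zero, neg_zero] }, rfl⟩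

/-- The value of a crossed homomorphism vanishing on a normal subgroup `I` at any `F` is
`I`-invariant. [folklore] -/
theorem smul_eq_of_normal (hg : ∀ σ τ, g (σ * τ) = g σ + σ • g τ) {I : Subgroup Γ}
    (hI : I.Normal) (hgI : ∀ τ ∈ I, g τ = 0) (F : Γ) {τ : Γ} (hτ : τ ∈ I) : τ • g F = g F := by
  have h1 : g (τ * F) = τ • g F := by rw [hg, hgI τ hτ, zero_add]
  have h2 : g (F * (F⁻¹ * τ * F)) = g F := by
    rw [hg, hgI _ (hI.conj_mem' τ hτ F), smul_zero, add_zero]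
  rw [show F * (F⁻¹ * τ * F) = τ * F by group] at h2
  rw [← h1, h2]

end CrossedHom

/-! ### Tools on the local Galois side -/

section Local

variable {K : Type} [Field K] [NumberField K] (W : WeierstrassCurve K) [W.IsElliptic]
  (v : HeightOneSpectrum (𝓞 K))


omit [W.IsElliptic] in
/-- A Tate parametrisation `Ψ` with kernel `q^ℤ`, `0 < |q|_v < 1`, is injective on the roots of unity
of any order `p ≠ 0`: `Ψ(ζ₁) = Ψ(ζ₂)`, `ζ₁^p = ζ₂^p = 1 ⟹ ζ₁ = ζ₂`. [folklore] -/
theorem eq_of_pow_eq_one_of_map_ofMul_eq {q : (v.adicCompletion K)} (hq0 : q ≠ 0)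
    (hq1 : Valued.v q < 1) (Ψ : Additive (AlgebraicClosure (v.adicCompletion K))ˣ →+ localPoints W (v.adicCompletion K))
    (hker : ∀ u : (AlgebraicClosure (v.adicCompletion K))ˣ, Ψ (Additive.ofMul u) = 0 ↔ ∃ n : ℤ,
      (u : (AlgebraicClosure (v.adicCompletion K))) = algebraMap (v.adicCompletion K) (AlgebraicClosure (v.adicCompletion K)) q ^ n)
    {p : ℕ} (hp : p ≠ 0) {ζ₁ ζ₂ : (AlgebraicClosure (v.adicCompletion K))ˣ} (h₁ : ζ₁ ^ p = 1)
    (h₂ : ζ₂ ^ p = 1) (h : Ψ (Additive.ofMul ζ₁) = Ψ (Additive.ofMul ζ₂)) : ζ₁ = ζ₂ := by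
  have h0 : Ψ (Additive.ofMul (ζ₁ / ζ₂)) = 0 := by rw [ofMul_div, map_sub, h, sub_self]
  obtain ⟨n, hn⟩ := (hker _).mp h0
  have h3 : algebraMap (v.adicCompletion K) (AlgebraicClosure (v.adicCompletion K)) q ^ (n * p) = 1 := by
    rw [zpow_mul, ← hn, zpow_natCast, ← Units.val_pow_eq_pow_val, div_pow, h₁, h₂, div_one,
      Units.val_one]
  have h4 : n * p = 0 := zpow_algebraMap_eq_one_imp v hq0 hq1 h3
  have h5 : n = 0 := by
    rcases mul_eq_zero.mp h4 with h | h
    · exact h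
    · exact absurd h (by exact_mod_cast hp)
  rw [h5, zpow_zero] at hn
  exact div_eq_one.mp (Units.ext hn)


omit [W.IsElliptic] in
/-- **The `σ ∈ Γ_{(v.adicCompletion K)}` at which a crossed homomorphism `g : Γ_{(v.adicCompletion K)} → E(K̄_v)` takes its value on
the line `Ψ(μ_p)` form a subgroup**, for a twisted-equivariant parametrisation
`σ • Ψ(u) = Ψ((σu)^{ε σ})` (the line is `Γ_{(v.adicCompletion K)}`-stable and `g(στ) = g σ + σ g τ`,
`g σ⁻¹ = -σ⁻¹ g σ`). [folklore] -/
theorem exists_subgroup_coe_eq_setOf_mem_line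
    (Ψ : Additive (AlgebraicClosure (v.adicCompletion K))ˣ →+ localPoints W (v.adicCompletion K)) (ε : (absoluteGaloisGroup (v.adicCompletion K)) → ℤ)
    (hε : ∀ (σ : (absoluteGaloisGroup (v.adicCompletion K))) (u : (AlgebraicClosure (v.adicCompletion K))ˣ), σ • Ψ (Additive.ofMul u) =
      Ψ (Additive.ofMul (((Units.map (absoluteGaloisGroup.toAlgEquiv (v.adicCompletion K) σ : AlgebraicClosure (v.adicCompletion K) →* AlgebraicClosure (v.adicCompletion K))) u) ^ ε σ)))
    {g : (absoluteGaloisGroup (v.adicCompletion K)) → localPoints W (v.adicCompletion K)} (hg : ∀ σ τ, g (σ * τ) = g σ + σ • g τ) (p : ℕ) :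
    ∃ A : Subgroup (absoluteGaloisGroup (v.adicCompletion K)), (A : Set (absoluteGaloisGroup (v.adicCompletion K))) = {σ | ∃ ζ : (AlgebraicClosure (v.adicCompletion K))ˣ, ζ ^ p = 1 ∧ g σ = Ψ (Additive.ofMul ζ)} :=
  ⟨{ carrier := {σ | ∃ ζ : (AlgebraicClosure (v.adicCompletion K))ˣ, ζ ^ p = 1 ∧ g σ = Ψ (Additive.ofMul ζ)}
     one_mem' := ⟨1, one_pow _, by rw [crossedHom_one hg, ofMul_one, map_zero]⟩
     mul_mem' := by
       rintro σ τ ⟨ζ₁, h₁, e₁⟩ ⟨ζ₂, h₂, e₂⟩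
       refine ⟨ζ₁ * ((Units.map (absoluteGaloisGroup.toAlgEquiv (v.adicCompletion K) σ : AlgebraicClosure (v.adicCompletion K) →* AlgebraicClosure (v.adicCompletion K))) ζ₂) ^ ε σ, ?_, ?_⟩
       · rw [mul_pow, h₁, one_mul, ← zpow_natCast, ← zpow_mul, mul_comm, zpow_mul,
           zpow_natCast, ← map_pow, h₂, map_one, one_zpow]
       · rw [hg, e₁, e₂, hε σ ζ₂, ofMul_mul, map_add]
     inv_mem' := by
       rintro σ ⟨ζ, h, e⟩
       refine ⟨(((Units.map (absoluteGaloisGroup.toAlgEquiv (v.adicCompletion K) σ⁻¹ : AlgebraicClosure (v.adicCompletion K) →* AlgebraicClosure (v.adicCompletion K))) ζ) ^ ε σ⁻¹)⁻¹, ?_, ?_⟩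
       · rw [inv_pow, ← zpow_natCast, ← zpow_mul, mul_comm, zpow_mul, zpow_natCast,
           ← map_pow, h, map_one, one_zpow, inv_one]
       · rw [crossedHom_inv hg σ, e, hε σ⁻¹ ζ, ofMul_inv, map_neg] }, rfl⟩

omit [W.IsElliptic] in
/-- **A local arithmetic Frobenius moving `t`.** Let `t ∈ K̄_v` with `σ t = ± t` for every
`σ ∈ Γ_{(v.adicCompletion K)}` and `-t ≠ t`, moved by SOME element of `Γ_{(v.adicCompletion K)}`. Then there is an arithmetic
Frobenius `F` at the prime `𝔐` of the local absolute integers (`F b ≡ b^{q_v} (mod 𝔐)`, Mathlib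
`IsArithFrobAt`) with `F t ≠ t`: start from any Frobenius `F₀`
(`exists_isArithFrobAt_localAbsIntegers`); if `F₀ t = t`, some inertia element `τ` moves `t` —
otherwise the open subgroup `Stab(t)` contains `F₀` and `I_𝔐`, hence is all of `Γ_{(v.adicCompletion K)}`
(`eq_top_of_isOpen_of_frobenius_mem_of_inertia_le`) — and `F₀ τ` is a Frobenius moving `t`.
[cite: NeukirchANT1999, Ch. II §9 Prop. (9.9)–(9.11)] -/
theorem exists_isArithFrobAt_apply_ne {𝔐 : Ideal (v.localAbsIntegers)}
    (h𝔐 : 𝔐 ∈ v.localPrimesAbove) {t : (AlgebraicClosure (v.adicCompletion K))}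
    (hσt : ∀ σ : (absoluteGaloisGroup (v.adicCompletion K)), (absoluteGaloisGroup.toAlgEquiv (v.adicCompletion K) σ) t = t ∨ (absoluteGaloisGroup.toAlgEquiv (v.adicCompletion K) σ) t = -t) (htne : -t ≠ t)
    (hex : ∃ σ₀ : (absoluteGaloisGroup (v.adicCompletion K)), (absoluteGaloisGroup.toAlgEquiv (v.adicCompletion K) σ₀) t ≠ t) :
    ∃ F : (absoluteGaloisGroup (v.adicCompletion K)), IsArithFrobAt (v.adicCompletionIntegers K) F 𝔐 ∧ (absoluteGaloisGroup.toAlgEquiv (v.adicCompletion K) F) t ≠ t := by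
  obtain ⟨σ₀, hσ₀⟩ := hex
  obtain ⟨F₀, hF₀⟩ := v.exists_isArithFrobAt_localAbsIntegers h𝔐
  by_cases hF₀t : (absoluteGaloisGroup.toAlgEquiv (v.adicCompletion K) F₀) t = t
  · obtain ⟨τ, hτ, hτt⟩ : ∃ τ ∈ 𝔐.inertia (absoluteGaloisGroup (v.adicCompletion K)), (absoluteGaloisGroup.toAlgEquiv (v.adicCompletion K) τ) t ≠ t := by
      by_contra hall
      push Not at hall
      have hopen : IsOpen ((MulAction.stabilizer (absoluteGaloisGroup (v.adicCompletion K)) t : Subgroup (absoluteGaloisGroup (v.adicCompletion K))) : Set (absoluteGaloisGroup (v.adicCompletion K))) :=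
        stabilizer_isOpen_of_isIntegral t
      have htop := v.eq_top_of_isOpen_of_frobenius_mem_of_inertia_le h𝔐 hF₀ hopen
        (MulAction.mem_stabilizer_iff.mpr hF₀t)
        (fun τ hτ ↦ MulAction.mem_stabilizer_iff.mpr (hall τ hτ))
      have hmem : σ₀ ∈ MulAction.stabilizer (absoluteGaloisGroup (v.adicCompletion K)) t := by rw [htop]; exact Subgroup.mem_top σ₀
      exact hσ₀ (MulAction.mem_stabilizer_iff.mp hmem)
    refine ⟨F₀ * τ, isArithFrobAt_mul_of_mem_inertia hF₀ hτ, ?_⟩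
    rw [map_mul, AlgEquiv.mul_apply, (hσt τ).resolve_left hτt, map_neg, hF₀t]
    exact htne
  · exact ⟨F₀, hF₀, hF₀t⟩

end Local

end NonsplitKummer

end Summit.BirchSwinnertonDyer.Rank1Residual.GaloisImage

end
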